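import Mathlib
import Summits.ValiantsHypothesis.ValiantsHypothesis.Theorems.RigidityForcesSymmetryRankRigidMinimalReprLaplaceFiveSeparatedCaptureDefs
import Summits.ValiantsHypothesis.ValiantsHypothesis.Theorems.RigidityForcesSymmetryRankRigidMinimalReprLaplaceFiveRelabel

/-!
# ValiantsHypothesis / RigidityForcesSymmetry — crux `LaplaceOptimalFive` (stmt-ValiantsHypothesis-24813):
# SEPARATED CAPTURE — the profile `2K₂` without side-symmetry — part 1/2: LEMMA W (hub injectivity) and one-direction capture

Crux idea #8 `separated-capture` (val-idea-19 g8; `Cruxes/LaplaceOptimalFive/Ideas/separated-capture.md` r4,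
`Cruxes/LaplaceOptimalFive/SeparatedCaptureSketch.lean` r4 @8c37d69649eb, memo `SeparatedCaptureLemmaH.md` @c6e1de38a657; referee
val-idea-crit-3 g5, PASS-WITH-PRICE — this file is the sharpened price P1).

MECHANISM.  On a `{3,4}`-SEPARATED pair profile (short sides among `01, 02, 12 | 34`) contract the exactness identity
`Σ_t u_t ⊗ w_t = P₅` against a leaf matrix `μ` on the slots `{3,4}` that annihilates every `{3,4}`-short factor: the leaf terms die and
the OBLIGATION TENSOR `P₅ ⌞ μ` (a symmetric 3-tensor on the slots `0,1,2`) is CAPTURED by the triangle configuration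
`U₀₁ ⊗ V₂ + U₀₂ ⊗ V₁ + U₁₂ ⊗ V₀` of short-factor spans (`obligation_captured`).  Contracting the free slot `2` against `𝟙` (the HUB
CONTRACTION) maps the ten obligations bijectively onto the symmetric zero-diagonal `5 × 5` matrices — LEMMA W: the pairs-vs-triples
inclusion matrix `W₂₃(5)`, alias the adjacency matrix `A` of the Petersen graph, is nonsingular, `A⁻¹ = (A + I − J/3)/2`
(`hub_injective`, ten explicit linear combinations) — and maps `U₀₁ ⊗ V₂` into `U₀₁`.  Hence, when there are no `02`/`12` terms,
`10 − n₃₄ ≤ dim W ≤ dim U₀₁ ≤ n₀₁` (`capture_one_direction`, `twoK2`): **every split decomposition of `P₅` on the cuts `{0,1}`, `{3,4}`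
(any multiplicities, off-shell factors, side-symmetric OR NOT) has at least ten terms, weight `≥ 120`**; `twoK2_relabel` moves it to any
two disjoint pairs.  To our knowledge the first K1-type kernel theorem WITHOUT the `SideSymmetric` hypothesis (the sum-rigidity census
✓ p662460 … ✓ p672506 is side-symmetric throughout).

HONEST FRAMING.  A SPECIAL CASE only: `LaplaceOptimalFive` (stmt-24813) stays OPEN · CONTESTED 72/120 (the general separated profile
`{01,02,12,34}` is EQUIVALENT to the open 3-slot capture inequality `CaptureIneq` of the sketch; hub profiles are untouched);
`RankRigidMinimalRepr`, the route, and `VP ≠ VNP` are NOT proved.  No `sorry`, no new axioms; Mathlib + tree only.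

THIS MODULE: `ofFn_word`, `perm5_word`, ★ `hub_injective` (Lemma W), the linear maps `cZ` / `hub`, `L3_le_comap_hub`, ★ `capture_one_direction` (= the sketch's `CaptureIneq` at `U₀₂ = U₁₂ = 0`).

PORT NOTE (val-port-4 g3, desk RULING #358 (A)): this is val-idea-19 g8's crux workfile
`Cruxes/LaplaceOptimalFive/SeparatedCaptureTwoK2.lean` (sha16 f66f20c184baed76, farm rc 0 / 0 sorry / 0 warnings, std axioms) with
(i) the six vocabulary defs `perm5`/`word`/`contractZ`/`L3`/`short2`/`shortSpan` taken BY NAME from ✓ `…LaplaceFiveSeparatedCaptureDefs`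
(byte-identical bodies, same namespace — proofs unchanged), (ii) the 400-line split `…TwoK2Hub` (Lemma W + one-direction capture) →
`…TwoK2` (obligations captured + the theorem), (iii) five docstrings added.  Proof texts VERBATIM.
-/

set_option linter.dupNamespace false
set_option autoImplicit false

namespace Summit.ValiantsHypothesis.ValiantsHypothesis.Theorems.RigidityForcesSymmetryRankRigidMinimalRepr

namespace LaplaceFiveSeparatedCapture

open Finset LaplaceFiveSectorSplit

/-! ### Lemma W: the hub contraction is injective on symmetric zero-diagonal matrices -/

/-- The word as a list of its five letters. -/
lemma ofFn_word (p q r s t : Fin 5) : List.ofFn (word p q r s t) = [p, q, r, s, t] := by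
  simp [word, List.ofFn_succ]

/-- `perm5_word` — `P₅` of a word in terms of `List.Nodup` of its letters (see the proof). -/
lemma perm5_word (p q r s t : Fin 5) :
    perm5 (word p q r s t) = if [p, q, r, s, t].Nodup then 1 else 0 := by
  unfold perm5
  by_cases h : Function.Injective (word p q r s t)
  · rw [if_pos h, if_pos]
    rw [← ofFn_word]
    exact List.nodup_ofFn.mpr h
  · rw [if_neg h, if_neg]
    rw [← ofFn_word]
    exact fun h' => h (List.nodup_ofFn.mp h')

set_option maxHeartbeats 1600000 in
/-- LEMMA W (hub contraction is injective on symmetric zero-diagonal matrices; the Petersen graph is nonsingular,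
`A⁻¹ = (A + I − J/3)/2`). -/
theorem hub_injective (μ : Fin 5 → Fin 5 → ℂ) (hs : ∀ s t, μ s t = μ t s) (hd : ∀ s, μ s s = 0)
    (hG : ∀ p q : Fin 5, (∑ r : Fin 5, contractZ μ p q r) = 0) : μ = 0 := by
  have e01 := hG 0 1
  have e02 := hG 0 2
  have e03 := hG 0 3
  have e04 := hG 0 4
  have e12 := hG 1 2
  have e13 := hG 1 3
  have e14 := hG 1 4
  have e23 := hG 2 3
  have e24 := hG 2 4
  have e34 := hG 3 4
  simp only [contractZ, Fin.sum_univ_five, perm5_word] at e01 e02 e03 e04 e12 e13 e14 e23 e24 e34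
  norm_num [List.nodup_cons, Fin.ext_iff] at e01 e02 e03 e04 e12 e13 e14 e23 e24 e34
  rw [hs 3 2, hs 4 2, hs 4 3] at e01
  rw [hs 3 1, hs 4 1, hs 4 3] at e02
  rw [hs 2 1, hs 4 1, hs 4 2] at e03
  rw [hs 2 1, hs 3 1, hs 3 2] at e04
  rw [hs 3 0, hs 4 0, hs 4 3] at e12
  rw [hs 2 0, hs 4 0, hs 4 2] at e13
  rw [hs 2 0, hs 3 0, hs 3 2] at e14
  rw [hs 1 0, hs 4 0, hs 4 1] at e23
  rw [hs 1 0, hs 3 0, hs 3 1] at e24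
  rw [hs 1 0, hs 2 0, hs 2 1] at e34
  have n01 : μ 0 1 = 0 := by linear_combination (1/6 : ℂ) * (e01 + e23 + e24 + e34) - (1/12 : ℂ) * (e02 + e03 + e04 + e12 + e13 + e14)
  have n02 : μ 0 2 = 0 := by linear_combination (1/6 : ℂ) * (e02 + e13 + e14 + e34) - (1/12 : ℂ) * (e01 + e03 + e04 + e12 + e23 + e24)
  have n03 : μ 0 3 = 0 := by linear_combination (1/6 : ℂ) * (e03 + e12 + e14 + e24) - (1/12 : ℂ) * (e01 + e02 + e04 + e13 + e23 + e34)
  have n04 : μ 0 4 = 0 := by linear_combination (1/6 : ℂ) * (e04 + e12 + e13 + e23) - (1/12 : ℂ) * (e01 + e02 + e03 + e14 + e24 + e34)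
  have n12 : μ 1 2 = 0 := by linear_combination (1/6 : ℂ) * (e12 + e03 + e04 + e34) - (1/12 : ℂ) * (e01 + e02 + e13 + e14 + e23 + e24)
  have n13 : μ 1 3 = 0 := by linear_combination (1/6 : ℂ) * (e13 + e02 + e04 + e24) - (1/12 : ℂ) * (e01 + e03 + e12 + e14 + e23 + e34)
  have n14 : μ 1 4 = 0 := by linear_combination (1/6 : ℂ) * (e14 + e02 + e03 + e23) - (1/12 : ℂ) * (e01 + e04 + e12 + e13 + e24 + e34)
  have n23 : μ 2 3 = 0 := by linear_combination (1/6 : ℂ) * (e23 + e01 + e04 + e14) - (1/12 : ℂ) * (e02 + e03 + e12 + e13 + e24 + e34)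
  have n24 : μ 2 4 = 0 := by linear_combination (1/6 : ℂ) * (e24 + e01 + e03 + e13) - (1/12 : ℂ) * (e02 + e04 + e12 + e14 + e23 + e34)
  have n34 : μ 3 4 = 0 := by linear_combination (1/6 : ℂ) * (e34 + e01 + e02 + e12) - (1/12 : ℂ) * (e03 + e04 + e13 + e14 + e23 + e24)
  have key : ∀ s t : Fin 5, s < t → μ s t = 0 := by
    intro s t hst
    fin_cases s <;> fin_cases t <;> simp (config := {decide := true}) at hst ⊢ <;> assumption
  funext s t
  rcases lt_trichotomy s t with hlt | rfl | hgt
  · exact key s t hlt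
  · exact hd s
  · rw [hs]; exact key t s hgt

/-! ### The hub contraction as a linear map; it sends `U₀₁ ⊗ V₂` into `U₀₁` -/

/-- `contractZ` as a linear map. -/
def cZ : (Fin 5 → Fin 5 → ℂ) →ₗ[ℂ] (Fin 5 → Fin 5 → Fin 5 → ℂ) where
  toFun := contractZ
  map_add' := by
    intro μ μ'
    funext p q r
    simp only [contractZ, Pi.add_apply, add_mul, Finset.sum_add_distrib]
  map_smul' := by
    intro c μ
    funext p q r
    simp only [contractZ, Pi.smul_apply, smul_eq_mul, RingHom.id_apply, Finset.mul_sum, mul_assoc]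

/-- `cZ` is `contractZ` as a linear map. -/
lemma cZ_apply (μ : Fin 5 → Fin 5 → ℂ) : cZ μ = contractZ μ := rfl

/-- HUB CONTRACTION: sum out the free triangle slot `2` (contraction against `𝟙`). -/
def hub : (Fin 5 → Fin 5 → Fin 5 → ℂ) →ₗ[ℂ] (Fin 5 → Fin 5 → ℂ) where
  toFun T := fun p q => ∑ r : Fin 5, T p q r
  map_add' := by
    intro T T'
    funext p q
    simp only [Pi.add_apply, Finset.sum_add_distrib]
  map_smul' := by
    intro c T
    funext p q
    simp only [Pi.smul_apply, smul_eq_mul, RingHom.id_apply, Finset.mul_sum]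

/-- The hub contraction entrywise: `hub T p q = Σ_r T p q r`. -/
lemma hub_apply (T : Fin 5 → Fin 5 → Fin 5 → ℂ) (p q : Fin 5) : hub T p q = ∑ r : Fin 5, T p q r := rfl

/-- With no `02` / `12` directions, the hub contraction maps the triangle configuration space into `U₀₁`. -/
lemma L3_le_comap_hub (U01 : Submodule ℂ (Fin 5 → Fin 5 → ℂ)) : L3 U01 ⊥ ⊥ ≤ U01.comap hub := by
  unfold L3
  rw [Submodule.span_le]
  rintro T hT
  simp only [Set.mem_union, Set.mem_setOf_eq] at hT
  rw [SetLike.mem_coe, Submodule.mem_comap]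
  rcases hT with (⟨u, hu, y, rfl⟩ | ⟨u, hu, y, rfl⟩) | ⟨u, hu, y, rfl⟩
  · have h : hub (fun p q r => u p q * y r) = (∑ r : Fin 5, y r) • u := by
      funext p q
      simp only [hub_apply, Pi.smul_apply, smul_eq_mul, Finset.sum_mul]
      exact Finset.sum_congr rfl fun r _ => mul_comm _ _
    rw [h]
    exact U01.smul_mem _ hu
  · rw [(Submodule.mem_bot ℂ).mp hu]
    have h : hub (fun p q r => (0 : Fin 5 → Fin 5 → ℂ) p r * y q) = 0 := by
      funext p q
      simp [hub_apply]
    rw [h]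
    exact U01.zero_mem
  · rw [(Submodule.mem_bot ℂ).mp hu]
    have h : hub (fun p q r => (0 : Fin 5 → Fin 5 → ℂ) q r * y p) = 0 := by
      funext p q
      simp [hub_apply]
    rw [h]
    exact U01.zero_mem

/-- **ONE-DIRECTION CAPTURE INEQUALITY** (`CaptureIneq` of the sketch with `U₀₂ = U₁₂ = 0`): if every obligation `P₅ ⌞ μ`,
`μ` in a space `W` of symmetric zero-diagonal matrices, is captured by `U₀₁ ⊗ V₂`, then `dim W ≤ dim U₀₁`.  Proof: `hub ∘ contractZ`
maps `W` injectively (Lemma W) into `U₀₁`. [new] -/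
theorem capture_one_direction (U01 U02 U12 W : Submodule ℂ (Fin 5 → Fin 5 → ℂ)) (h02 : U02 = ⊥) (h12 : U12 = ⊥)
    (hWs : ∀ μ ∈ W, ∀ s t : Fin 5, μ s t = μ t s) (hWd : ∀ μ ∈ W, ∀ s : Fin 5, μ s s = 0)
    (hWc : ∀ μ ∈ W, contractZ μ ∈ L3 U01 U02 U12) :
    Module.finrank ℂ W ≤ Module.finrank ℂ U01 + Module.finrank ℂ U02 + Module.finrank ℂ U12 := by
  subst h02
  subst h12
  simp only [finrank_bot, add_zero]
  have hGmem : ∀ μ ∈ W, (hub ∘ₗ cZ) μ ∈ U01 := fun μ hμ =>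
    Submodule.mem_comap.mp (L3_le_comap_hub U01 (hWc μ hμ))
  let f : W →ₗ[ℂ] U01 := LinearMap.codRestrict U01 ((hub ∘ₗ cZ).domRestrict W) (fun x => hGmem x.1 x.2)
  apply LinearMap.finrank_le_finrank_of_injective (f := f)
  rw [injective_iff_map_eq_zero]
  intro x hx
  have h0 : (hub ∘ₗ cZ) x.1 = 0 := by
    have := congrArg Subtype.val hx
    simpa [f] using this
  have hμ : (x.1 : Fin 5 → Fin 5 → ℂ) = 0 :=
    hub_injective x.1 (hWs x.1 x.2) (hWd x.1 x.2) (fun p q => by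
      have := congrFun (congrFun h0 p) q
      simpa [hub_apply, cZ_apply] using this)
  exact Subtype.ext hμ


end LaplaceFiveSeparatedCapture

end Summit.ValiantsHypothesis.ValiantsHypothesis.Theorems.RigidityForcesSymmetryRankRigidMinimalRepr
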